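import Literature.NumberTheory.GaloisRepresentations.LocalBrauerRestrictionDegree
import Literature.NumberTheory.GaloisRepresentations.KummerTwo
import HarnessLib

/-!
# A `μ_p`-valued `2`-cocycle of a local field splits on every open subgroup of index divisible by `p`
# (Serre, *Corps locaux* XIII §3 Prop. 7; *Cohomologie galoisienne* II §3.3 Prop. 9 — explicit form)

Topic `NumberTheory/GaloisRepresentations`; namespace `Literature.NumberTheory.GaloisRepresentations`.
Theorems only (no definition, no named fact; D-0026).

Let `F` be a non-archimedean local field of characteristic `0`, `Γ_F = Gal(F̄/F)`, `p` a prime.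
The tree's `resSub_two_mu_eq_zero_of_dvd_relIndex` (`LocalBrauerRestrictionDegree.lean`, Serre,
*Corps locaux* XIII §3 Prop. 7: `Br(E)[n] → Br(L)` vanishes when `n ∣ [L : E]`) says that every class
of `H²(Gal(F̄/E), μ_p)` dies on `Gal(F̄/L)` for `p ∣ [L : E]`.  This file is its EXPLICIT-COCYCLE
form over `E = F`, in the language of the Hasse-principle files (`BrauerGroupCocycles.lean`,
`BrauerHassePrinciple.lean`): 

* `exists_contTwoCocycles_mu_top_eq` — a locally constant `2`-cocycle `e : Γ_F × Γ_F → F̄ˣ` with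
  values in the `p`-th roots of unity (`e(σ,τ)^p = 1`) defines a continuous cocycle of the module
  `μ_p` over the subgroup `⊤ = Gal(F̄/F)` (dictionary; any field `F`);
* `exists_cob_on_subgroup_of_pow_eq_one_of_dvd_index` — **for every open subgroup `U ≤ Γ_F` with
  `p ∣ (Γ_F : U)` such an `e` is, on `U`, the coboundary of a locally constant cochain
  `b : U → F̄ˣ`**: `e(x,y) = b(x) · x b(y) · b(xy)⁻¹` for `x, y ∈ U` (`U = Gal(F̄/L)` for a finite
  `L/F` with `p ∣ [L : F]`, `exists_galFixing_eq_of_isOpen`; the class of `e` in `H²(Γ_F, μ_p)`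
  restricts to `0` on `Gal(F̄/L)`; unfold with `twoCocycleClass_eq_zero_iff`).

It is the local input at the finitely many "bad" places of the global killing of `Br(k)[p]` along the
cyclotomic `ℤ_p`-tower (Serre II §4.4 Prop. 13, the tree's named fact `fieldCdLE_two_of_numberField`).

## References

* J.-P. Serre, *Corps locaux*, Hermann, 1968, XIII §3 Prop. 7 and Cor. 3. [SerreLocalFields1979]
* J.-P. Serre, *Cohomologie galoisienne* / *Galois Cohomology* (1997), II §3.3 Prop. 9, II §4.4
  Prop. 13. [SerreGaloisCohomology1997]
-/

noncomputable section

open CategoryTheory Function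
open Field IntermediateField

universe u

namespace Literature.NumberTheory.GaloisRepresentations

open _root_.TopRep _root_.ContRepresentation _root_.ContinuousCohomology DiscreteGaloisModule
open LocalWeilDatum

/-! ### Dictionary: `μ_p`-valued explicit cocycles as continuous cocycles of `μ_p` -/

section AnyField

variable (F : Type u) [Field F] {p : ℕ} [hp : Fact p.Prime]

omit hp in
/-- **A locally constant `μ_p`-valued `2`-cocycle `e : Γ_F × Γ_F → F̄ˣ` defines a continuous
`2`-cocycle of the discrete module `μ_p` restricted to a closed subgroup `S ≤ Γ_F`**, with values
`e(x,y)` (the `2`-cocycle identity `e(σ,τ) e(στ,υ) = σe(τ,υ) e(σ,τυ)` read in `μ_p ⊂ F̄ˣ`).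
[cite: SerreGaloisCohomology1997, I §2.2–2.3, II §1.2] -/
theorem exists_contTwoCocycles_mu_subgroup_eq (S : Subgroup (absoluteGaloisGroup F))
    [IsClosed (S : Set (absoluteGaloisGroup F))]
    (e : absoluteGaloisGroup F → absoluteGaloisGroup F → (AlgebraicClosure F)ˣ)
    (hlc : IsLocallyConstant fun q : absoluteGaloisGroup F × absoluteGaloisGroup F => e q.1 q.2)
    (hcoc : ∀ σ τ υ, e σ τ * e (σ * τ) υ = σ • e τ υ * e σ (τ * υ))
    (hep : ∀ σ τ, e σ τ ^ p = 1) :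
    ∃ c : contTwoCocycles ((mu F p).restrict (subgroupIncl S)).toTopRep,
      ∀ x y : S, ((MuCarrier.toAdditive (c.1 (x, y))).toMul : (AlgebraicClosure F)ˣ) = e x y := by
  haveI := absoluteGaloisGroup_compactSpace F
  -- the `μ_p`-valued function
  let ζ : absoluteGaloisGroup F → absoluteGaloisGroup F → rootsOfUnity p (AlgebraicClosure F) :=
    fun σ τ => ⟨e σ τ, by rw [mem_rootsOfUnity]; exact hep σ τ⟩
  have hζ : ∀ σ τ, ((ζ σ τ : rootsOfUnity p (AlgebraicClosure F)) : (AlgebraicClosure F)ˣ) = e σ τ :=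
    fun _ _ => rfl
  let f₀ : S × S → MuCarrier F p := fun q => MuCarrier.ofRootsOfUnity (ζ q.1 q.2)
  have hf₀lc : IsLocallyConstant f₀ := by
    have h1 : IsLocallyConstant fun q : S × S => e q.1 q.2 :=
      hlc.comp_continuous (f := fun q : S × S => ((q.1 : absoluteGaloisGroup F), (q.2 : absoluteGaloisGroup F)))
        (by fun_prop)
    refine (IsLocallyConstant.iff_exists_open _).2 fun q => ?_
    obtain ⟨U, hU, hqU, hconst⟩ := (IsLocallyConstant.iff_exists_open _).1 h1 q
    refine ⟨U, hU, hqU, fun q' hq' => ?_⟩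
    have h2 := hconst q' hq'
    change MuCarrier.ofRootsOfUnity (ζ q'.1 q'.2) = MuCarrier.ofRootsOfUnity (ζ q.1 q.2)
    congr 1
    exact Subtype.ext (Units.ext (by rw [hζ, hζ]; exact congrArg (fun u : (AlgebraicClosure F)ˣ => (u : AlgebraicClosure F)) h2))
  let f : C(S × S, MuCarrier F p) := ⟨f₀, hf₀lc.continuous⟩
  have hfval : ∀ x y : S, ((MuCarrier.toAdditive (f (x, y))).toMul : (AlgebraicClosure F)ˣ) = e x y :=
    fun _ _ => rfl
  refine ⟨⟨f, fun x y w => ?_⟩, hfval⟩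
  -- the cocycle identity in `μ_p`, read in `F̄ˣ`
  apply MuCarrier.toAdditive.injective
  apply Additive.toMul.injective
  apply Subtype.ext
  change ((x : absoluteGaloisGroup F) • e y w) * e x (y * w) = e (x * y) w * e x y
  rw [← hcoc, mul_comm]

end AnyField

/-! ### Local fields: splitting on open subgroups of index divisible by `p` -/

section Local

variable (F : Type u) [Field F] [ValuativeRel F] [TopologicalSpace F] [IsNonarchimedeanLocalField F]
  [CharZero F] {p : ℕ} [hp : Fact p.Prime]

/-- **A `μ_p`-valued locally constant `2`-cocycle of a local field is a coboundary on every open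
subgroup of index divisible by `p`.**  Let `F` be a non-archimedean local field of characteristic `0`,
`e : Γ_F × Γ_F → F̄ˣ` a locally constant `2`-cocycle (`e(σ,τ) e(στ,υ) = σe(τ,υ) e(σ,τυ)`) with
`e(σ,τ)^p = 1`, and `U ≤ Γ_F` an open subgroup with `p ∣ (Γ_F : U)`.  Then there is a locally constant
`b : U → F̄ˣ` with `e(x,y) = b(x) · x b(y) · b(xy)⁻¹` for all `x, y ∈ U`.  Proof: `U = Gal(F̄/L)` for a
finite `L/F` (`exists_galFixing_eq_of_isOpen`) with `p ∣ [L : F] = (Γ_F : U)`; the class of `e` in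
`H²(Γ_F, μ_p)` (`exists_contTwoCocycles_mu_subgroup_eq` over `⊤ = Gal(F̄/F)`) restricts to `0` on
`Gal(F̄/L)` by Serre, *Corps locaux* XIII §3 Prop. 7 in the form
`resSub_two_mu_eq_zero_of_dvd_relIndex`; unfold the vanishing class (`twoCocycleClass_eq_zero_iff`).
[cite: SerreLocalFields1979, XIII §3 Prop. 7 and Cor. 3] [cite: SerreGaloisCohomology1997, II §3.3 Prop. 9] -/
theorem exists_cob_on_subgroup_of_pow_eq_one_of_dvd_index
    (e : absoluteGaloisGroup F → absoluteGaloisGroup F → (AlgebraicClosure F)ˣ)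
    (hlc : IsLocallyConstant fun q : absoluteGaloisGroup F × absoluteGaloisGroup F => e q.1 q.2)
    (hcoc : ∀ σ τ υ, e σ τ * e (σ * τ) υ = σ • e τ υ * e σ (τ * υ))
    (hep : ∀ σ τ, e σ τ ^ p = 1)
    (U : Subgroup (absoluteGaloisGroup F)) (hU : IsOpen (U : Set (absoluteGaloisGroup F)))
    (hpU : p ∣ U.index) :
    ∃ b : U → (AlgebraicClosure F)ˣ, IsLocallyConstant b ∧
      ∀ x y : U, e x y = b x * (x : absoluteGaloisGroup F) • b y / b (x * y) := by
  classical
  haveI := absoluteGaloisGroup_compactSpace F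
  -- `U = Gal(F̄/L)`
  obtain ⟨L, hLfin, hL⟩ := exists_galFixing_eq_of_isOpen U hU
  haveI := hLfin
  subst hL
  haveI : IsClosed ((galFixing F L : Subgroup (absoluteGaloisGroup F)) : Set (absoluteGaloisGroup F)) :=
    isClosed_galFixing' F L
  haveI : IsClosed ((galFixing F (⊥ : IntermediateField F (AlgebraicClosure F)) :
      Subgroup (absoluteGaloisGroup F)) : Set (absoluteGaloisGroup F)) := isClosed_galFixing' F ⊥
  haveI : CompactSpace (galFixing F L) := compactSpace_of_isClosed_subgroup
  haveI : CompactSpace (galFixing F (⊥ : IntermediateField F (AlgebraicClosure F))) :=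
    compactSpace_of_isClosed_subgroup
  -- the class of `e` over `⊤ = Gal(F̄/F)`
  obtain ⟨c, hc⟩ := exists_contTwoCocycles_mu_subgroup_eq F (p := p)
    (galFixing F (⊥ : IntermediateField F (AlgebraicClosure F))) e hlc hcoc hep
  -- Serre XIII §3 Prop. 7: it dies on `Gal(F̄/L)`
  have hpd : p ∣ (galFixing F L).relIndex (galFixing F (⊥ : IntermediateField F (AlgebraicClosure F))) := by
    rw [galFixing_bot, Subgroup.relIndex_top_right]
    exact hpU
  have hres := resSub_two_mu_eq_zero_of_dvd_relIndex F ⊥ L bot_le hp.out.pos hpd (twoCocycleClass _ c)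
  rw [resSub, map_twoCocycleClass, twoCocycleClass_eq_zero_iff] at hres
  obtain ⟨b, hb⟩ := hres
  refine ⟨fun x => ((MuCarrier.toAdditive (b x)).toMul : (AlgebraicClosure F)ˣ),
    (((IsLocallyConstant.iff_continuous b).2 b.continuous).comp _), fun x y => ?_⟩
  have key := hb x y
  rw [contTwoCocycles.pullback_apply, resSubMod_hom_apply] at key
  simp only [ContinuousRep.toContRepresentation_apply_apply, ContinuousRep.restrict_apply,
    subgroupIncl_apply] at key
  have hcxy := hc (inclHom (galFixing_antitone F (bot_le : (⊥ : IntermediateField F (AlgebraicClosure F)) ≤ L)) x)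
    (inclHom (galFixing_antitone F (bot_le : (⊥ : IntermediateField F (AlgebraicClosure F)) ≤ L)) y)
  rw [key, map_add, map_sub, mu_apply_apply, toMul_add, toMul_sub, toMul_ofMul, Subgroup.coe_mul,
    Subgroup.coe_div, absoluteGaloisGroup.coe_smul_rootsOfUnity] at hcxy
  change _ = e x y at hcxy
  rw [← hcxy]
  beta_reduce
  rw [mul_comm, mul_div_assoc]

end Local

end Literature.NumberTheory.GaloisRepresentations

end
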